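import Literature.MathematicalPhysics.QuantumFieldTheory.Balaban1983to89.B6QGGQ278Zd
import Summits.QuantumFields.BalabanUV.Beta.D1BFx.GhostLeg

/-!
# `BalabanUV.Beta.D1BFx.RProjector` — road «BF-x» for binder row D1, sub-leaf **J5.0**: the `U = 1` projector of the gauge term,
# B9 (3.25) `P = G′Q′*(Q′G′²Q′*)⁻¹Q′G′` (`R = 1 − P`), as a typed kernel on the WHOLE fine lattice `ℤ^d` (scalar, colour-stripped) over
# pv23's `Csq = (Q′G′²Q′*)⁻¹` and `gq = G′Q′*`: convergence, block-structured decay, symmetry, the Euler–Lagrange identities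
# `Δ′_a·(G′Q′*C) = Q′*C`, `Δ′_a·P = (n+1)^{−d}·Q′*CQ′G′`, and THE GAUGE PROPERTY `⟨λ, Δ^η P(·,p)⟩ = 0` for `λ ∈ N(Q′)` (`R = 1` on `Δ₀N(Q′)`)

HONEST FRAMING (cell contract, verbatim): «discharging `BetaPertH` makes Bałaban's UV stability UNCONDITIONAL — a real constructive-QFT
result; it is NOT the continuum limit and NOT the Clay problem.»  HONEST DEPENDENCY (verbatim): «continuum YM on T⁴ ⇐ BetaPertH ∧ nine
spine estimates (0/9 proved); BetaPertH ⇐ (D1) ∧ (D4) ∧ CAP+tail; G-an2-4 gates asym, D1 and NE2/3/4.»  THIS MODULE DISCHARGES NOTHING: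
three definitions with bodies (`kerP = G′Q′*C`, `Pker = (n+1)^{−d}·G′Q′*C Q′G′`, the road wrapper `Pgt`) plus [folklore] lattice bookkeeping
composed BY NAME from LANDED modules — pv23-g10's `B6QGGQ278Zd` (`Csq`, `kerSq`, `abs_Csq_le`, `tsum_Csq_mul_kerSq`, `kerSq_symm`,
`hyp56Z_KerSq`), pv23-g7's `B5Hk103ScalarZd` (`gq`, `abs_gq_le`, `sum_AX_mul_gq`, `summable_expX`, `tsum_expX_le`, `exp_split_triangle`,
`tsum_mul_tsum_comm`, `sum_mul_blockConst_eq_zero`, `nbhd`, `lapKer_eq_zero_of_not_mem`), `B6QGQLower276` (`AX`, `blk`, `B`),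
`B4Sect5Exhaustion.limInv_symm`, and the typer's `D1BFx/GhostLeg` (road currency `Ggh n a = Gk (n−1) a`).  No `Prop` is minted; nothing
printed is asserted; 0 sorry.  NOT summit progress; NOT BetaPertH, NOT continuum, NOT Clay.
ABSOLUTE RULE (cell, verbatim): «No internally-minted statement may enter as a cited fact. Every hypothesis is either kernel-proved in this
package or a verbatim quotation of a PUBLISHED theorem with page reference. The manuscript(s) under audit are NOT citable for their own
disputed steps — they are the thing under adjudication; programme-internal (2001/route/tribunal) claims are never citable.»

WHY (skeleton `HOME/beta/skeletons/D1-b2b-balaban-beta-d1-p2.md` node J5 «GAUGE-TERM jets ∂_A(D_A R_A D_A*)|₀»; `LEAVES-BFx.md` row J5, sub-row J5.0;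
reading note `HOME/b2b-balaban-beta-d1-formalise-leaf-09/g2/CHECK-K-R2.md` §6).  CONTEXT ONLY (renders `…1985-cmp99-background-propagators-p006/p007-x2.png`,
journal pp. 394–395 of [Balaban1985BackgroundPropagators], read as images by this seat; no printed statement is a hypothesis below): (3.21) «R =
Δ_U^η N(Q′), N(Q′) = {λ : Q′λ = 0}»; (3.25) «Rf = (I − G′Q′*(Q′G′²Q′*)⁻¹Q′G′) f, where G′ = G′(U) = (Δ′_a)⁻¹», p. 394 «Δ′_a = Δ′_a(U) = (Δ_U^η +
Q′*aQ′)↾Ω₀»; (3.26) «Δ_a = Δ + DRD* + Q*aQ».  So the projector is built from the MASSIVE scalar tower propagator `G′` and the block AVERAGING `Q′`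
(average-type `N(Q′)`); its one non-elementary ingredient `(Q′G′²Q′*)⁻¹` on `ℤ^d` is pv23-g10's `Csq` («the operator C», mesh-free decay).  THIS
FILE types `P` at `U = 1` (the object the jets are jets OF); the JETS `∂_A R` (J5 proper) are the typer's.
CONVENTIONS (of `B6QGQLower276` / `B5Hk103ScalarZd` / `B6QGGQ278Zd`, unchanged): fine sites `p, q ∈ X d = ℤ^d` (`η = 1/(n+1)` lattice), blocks
`B n y` of side `n + 1` (`blk n p`), `G′ = Gk n a` = the B4 Sect. 5 inverse of `AX n a = (n+1)²(−Δ_sites) + a(n+1)^{−d}·1[same block]` (= `Δ^η + aQ′*Q′`,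
`Q′f(y) = (n+1)^{−d}Σ_{B(y)}f`, `Q′*ω = ω ∘ blk`), `gq n a p y = Σ_{q∈B(y)} G′(p,q)` (= `G′Q′*`), `kerSq = (n+1)^{−d}(G′Q′*)ᵀ(G′Q′*)` (the matrix of
`Q′G′²Q′*` for the plain scalar product on the unit lattice), `Csq = limInv ℤ^d kerSq`; hence the matrix of `P` on fine site functions is
`Pker n a p q = (n+1)^{−d}·Σ'_y (G′Q′*C)(p,y)(G′Q′*)(q,y)`.  `Pker² = Pker` and `Q′G′·(1 − Pker) = 0` are v1.1 items; v1 proves decay, symmetry, the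
EL identities and `R = 1` on `Δ₀N(Q′)` — what K-R1/K-R2 (weighted datum `Δ_R = d*d + ∂R∂*`, CHECK-K-R2 §3 (R2-a)) need to STATE the `U = 1` operator.

CONTENT (all [folklore] / [our object]; `d` arbitrary, block side `n + 1`, `a > 0`).  §1 `Csq_symm`, `tsum_kerSq_mul_Csq`, `kerP`, `summable_kerP`,
`sum_mul_kerP`, `Pker`.  §2 `abs_kerP_le` (`≤ c_P·e^{−δ_P|blk p − y|_∞}`), `summable_Pker`, `abs_Pker_le` (`≤ c_PP·e^{−δ_PP|blk p − blk q|_∞}`: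
BLOCK-STRUCTURED, rate `O(1)` per block), `Pker_symm`.  §3 `sum_AX_mul_kerP`, `sum_mul_Pker`, `sum_AX_mul_Pker`.  §4 `sum_mul_AX_Pker_eq_zero`,
`sum_mul_sameBlk_Pker_eq_zero`, **`sum_mul_lap_Pker_eq_zero`** (`Σ_r λ(r)·Σ_q (n+1)²(−Δ)(r,q)P(q,p) = 0` for finitely supported `λ` with vanishing block
sums) and the pointwise form **`sum_Pker_mul_lap_eq_zero`** (`Σ_q P(p,q)(Δ^ηλ)(q) = 0`).  §5 road currency (`d = 4`, block side `n ≥ 1` as in `GhostLeg`):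
`Pgt n a : MKer 4 Unit`, `Pgt_apply`, `Pgt_symm`, `abs_Pgt_le`.
-/

namespace Summit.QuantumFields.BalabanUV.Beta.D1BFx.RProjector

open Finset Real Filter Topology
open Literature.MathematicalPhysics.QuantumFieldTheory.Balaban1983to89
open B4Sect5Exhaustion (limInv limInv_symm)
open B4Sect5Proof (latticeConst latticeConst_nonneg)
open B6QGQLower276 (X e blk B mem_B B_disjoint lapKer sameBlk AX AX_symm lapKer_symm gammaQ gammaQ_pos)
open B6QGQDecay237 (cU deltaU cU_pos deltaU_pos)
open B5Hk103ScalarZd (Gk gq abs_gq_le summable_expX tsum_expX_le exp_split_triangle tsum_mul_tsum_comm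
  summable_uncurry_of_majorant nbhd AX_eq_zero_of_not_mem lapKer_eq_zero_of_not_mem sum_AX_mul_gq sum_mul_blockConst_eq_zero)
open B6QGGQ278Zd (kerSq Csq cC deltaC cC_pos deltaC_pos abs_Csq_le tsum_Csq_mul_kerSq kerSq_symm hyp56Z_KerSq KerSq
  cSq_pos deltaSq_pos)

noncomputable section

variable {d : ℕ}

/-! ## §1 The kernels `G′Q′*C` and `P = η^d·G′Q′*C Q′G′` -/

/-- [folklore] `C = (Q′G′²Q′*)⁻¹` is symmetric (B4 Sect. 5 inverse of a symmetric kernel). -/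
theorem Csq_symm (n : ℕ) {a : ℝ} (ha : 0 < a) (y y' : X d) : Csq n a y y' = Csq n a y' y :=
  limInv_symm (pow_pos (gammaQ_pos d ha) 2) (cSq_pos d ha) (deltaSq_pos d ha) (hyp56Z_KerSq n ha) (y, 0) (y', 0)

/-- [folklore] The second one-sided inverse identity `(Q′G′²Q′*)·C = 1` (from `C·(Q′G′²Q′*) = 1` and symmetry of both kernels). -/
theorem tsum_kerSq_mul_Csq (n : ℕ) {a : ℝ} (ha : 0 < a) (y z : X d) :
    ∑' y' : X d, kerSq n a y y' * Csq n a y' z = if y = z then 1 else 0 := by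
  have h := tsum_Csq_mul_kerSq n ha z y
  have e : ∀ y' : X d, kerSq n a y y' * Csq n a y' z = Csq n a z y' * kerSq n a y' y := fun y' => by
    rw [kerSq_symm n a y y', Csq_symm n ha y' z, mul_comm]
  simp_rw [e, h, eq_comm]

/-- [our object] **`G′Q′*C`** (fine site `p`, block `y`): `kerP n a p y := Σ'_{y′} (G′Q′*)(p,y′)·C(y′,y)` — the pattern of
`B5Hk103ScalarZd.kerH` with `(Q′G′Q′*)⁻¹` replaced by `C = (Q′G′²Q′*)⁻¹`. -/
def kerP (n : ℕ) (a : ℝ) (p y : X d) : ℝ := ∑' y' : X d, gq n a p y' * Csq n a y' y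

/-- [our object] **THE PROJECTOR KERNEL** `Pker n a p q := (n+1)^{−d}·Σ'_y (G′Q′*C)(p,y)·(G′Q′*)(q,y)` — the matrix of B9 (3.25)'s
`P = G′Q′*(Q′G′²Q′*)⁻¹Q′G′` at `U = 1` (scalar, colour-stripped) acting on fine site functions. -/
def Pker (n : ℕ) (a : ℝ) (p q : X d) : ℝ := (((n : ℝ) + 1) ^ d)⁻¹ * ∑' y : X d, kerP n a p y * gq n a q y

/-- [folklore] The uniform bound on `G′Q′*` entries: `|(G′Q′*)(p,y)| ≤ c_u (n+1)^{d/2}`. -/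
theorem abs_gq_le_const (n : ℕ) {a : ℝ} (ha : 0 < a) (p y : X d) :
    |gq n a p y| ≤ cU d a * Real.sqrt (((n : ℝ) + 1) ^ d) := by
  refine (abs_gq_le n ha p y).trans ?_
  have he : Real.exp (-(deltaU d a * dist (blk n p) y)) ≤ 1 := by
    rw [Real.exp_le_one_iff, neg_nonpos]; exact mul_nonneg (deltaU_pos d ha).le dist_nonneg
  have h0 : 0 ≤ cU d a * Real.sqrt (((n : ℝ) + 1) ^ d) := by have := cU_pos d ha; positivity
  nlinarith

/-- [folklore] Absolute convergence of the series defining `G′Q′*C(p,y)` (majorant `c_u(n+1)^{d/2}c_C·e^{−δ_C|y−y′|}`). -/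
theorem summable_kerP (n : ℕ) {a : ℝ} (ha : 0 < a) (p y : X d) :
    Summable fun y' : X d => gq n a p y' * Csq n a y' y := by
  refine Summable.of_norm_bounded
    ((summable_expX (deltaC_pos d ha) y).mul_left (cU d a * Real.sqrt (((n : ℝ) + 1) ^ d) * cC d a)) fun y' => ?_
  rw [Real.norm_eq_abs, abs_mul]
  have h1 := abs_gq_le_const n ha p y'
  have h2 := abs_Csq_le n ha y' y
  rw [dist_comm] at h2
  calc |gq n a p y'| * |Csq n a y' y|
      ≤ (cU d a * Real.sqrt (((n : ℝ) + 1) ^ d)) * (cC d a * Real.exp (-(deltaC d a * dist y y'))) :=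
        mul_le_mul h1 h2 (abs_nonneg _) (by have := cU_pos d ha; positivity)
    _ = cU d a * Real.sqrt (((n : ℝ) + 1) ^ d) * cC d a * Real.exp (-(deltaC d a * dist y y')) := by ring

/-- [folklore] Finite sums against `G′Q′*C` pass inside the series. -/
theorem sum_mul_kerP (n : ℕ) {a : ℝ} (ha : 0 < a) (S : Finset (X d)) (v : X d → ℝ) (y : X d) :
    ∑ p ∈ S, v p * kerP n a p y = ∑' y' : X d, (∑ p ∈ S, v p * gq n a p y') * Csq n a y' y := by
  have hs : ∀ p ∈ S, Summable fun y' : X d => v p * (gq n a p y' * Csq n a y' y) :=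
    fun p _ => (summable_kerP n ha p y).mul_left (v p)
  calc ∑ p ∈ S, v p * kerP n a p y
      = ∑ p ∈ S, ∑' y' : X d, v p * (gq n a p y' * Csq n a y' y) :=
        Finset.sum_congr rfl fun p _ => by rw [kerP, tsum_mul_left]
    _ = ∑' y' : X d, ∑ p ∈ S, v p * (gq n a p y' * Csq n a y' y) := (Summable.tsum_finsetSum hs).symm
    _ = ∑' y' : X d, (∑ p ∈ S, v p * gq n a p y') * Csq n a y' y := by
        refine tsum_congr fun y' => ?_
        rw [Finset.sum_mul]; exact Finset.sum_congr rfl fun p _ => by ring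

/-! ## §2 Decay, summability and symmetry of `P` -/

/-- [folklore] A series dominated termwise by `M·e^{−β|x−y|_∞}` is bounded by `M·K_d(β)`. -/
theorem abs_tsum_le_latticeConst {f : X d → ℝ} {M β : ℝ} (hβ : 0 < β) (hM : 0 ≤ M) (x : X d)
    (h : ∀ y, |f y| ≤ M * Real.exp (-(β * dist x y))) : |∑' y : X d, f y| ≤ M * latticeConst d β := by
  have hsum : HasSum (fun y : X d => M * Real.exp (-(β * dist x y))) (M * ∑' y : X d, Real.exp (-(β * dist x y))) :=
    ((summable_expX hβ x).hasSum).mul_left _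
  have h1 := tsum_of_norm_bounded hsum fun y => by rw [Real.norm_eq_abs]; exact h y
  rw [Real.norm_eq_abs] at h1
  exact h1.trans (mul_le_mul_of_nonneg_left (tsum_expX_le hβ x) hM)

/-- [folklore] The decay rate of `G′Q′*C`: `δ_P(d,a) = min(δ_u, δ_C)/2`. -/
def deltaP (d : ℕ) (a : ℝ) : ℝ := min (deltaU d a) (deltaC d a) / 2

/-- [folklore] The constant of `G′Q′*C`: `c_P(d,n,a) = c_u (n+1)^{d/2} c_C K_d(δ_C/2)`. -/
def cP (d n : ℕ) (a : ℝ) : ℝ := cU d a * Real.sqrt (((n : ℝ) + 1) ^ d) * cC d a * latticeConst d (deltaC d a / 2)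

/-- [folklore] `δ_P > 0`. -/
theorem deltaP_pos (d : ℕ) {a : ℝ} (ha : 0 < a) : 0 < deltaP d a := by
  unfold deltaP; have := deltaU_pos d ha; have := deltaC_pos d ha; positivity

/-- [folklore] `c_P ≥ 0`. -/
theorem cP_nonneg (d n : ℕ) {a : ℝ} (ha : 0 < a) : 0 ≤ cP d n a := by
  unfold cP; have := cU_pos d ha; have := cC_pos d ha
  have := latticeConst_nonneg d (half_pos (deltaC_pos d ha)).le; positivity

/-- [folklore] **DECAY OF `G′Q′*C` IN THE BLOCK DISTANCE**: `|(G′Q′*C)(p,y)| ≤ c_P·e^{−δ_P|blk p − y|_∞}` (triangle split of the two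
exponential factors, then the lattice sum `K_d(δ_C/2)`). -/
theorem abs_kerP_le (n : ℕ) {a : ℝ} (ha : 0 < a) (p y : X d) :
    |kerP n a p y| ≤ cP d n a * Real.exp (-(deltaP d a * dist (blk n p) y)) := by
  have hδu := deltaU_pos d ha
  have hδC := deltaC_pos d ha
  set K : ℝ := cU d a * Real.sqrt (((n : ℝ) + 1) ^ d) * cC d a with hK
  have hK0 : 0 ≤ K := by rw [hK]; have := cU_pos d ha; have := cC_pos d ha; positivity
  -- termwise majorant after the triangle split, then the lattice sum `K_d(δ_C/2)`
  have key : |kerP n a p y|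
      ≤ (K * Real.exp (-(deltaP d a * dist (blk n p) y))) * latticeConst d (deltaC d a / 2) := by
    refine abs_tsum_le_latticeConst (half_pos hδC) (by positivity) y fun y' => ?_
    rw [abs_mul]
    have h1 := abs_gq_le n ha p y'
    have h2 := abs_Csq_le n ha y' y
    have hsplit := exp_split_triangle hδu.le hδC.le (dist_nonneg (x := blk n p) (y := y'))
      (dist_nonneg (x := y') (y := y)) (dist_triangle (blk n p) y' y)
    rw [dist_comm y' y] at hsplit
    calc |gq n a p y'| * |Csq n a y' y|
        ≤ (cU d a * Real.sqrt (((n : ℝ) + 1) ^ d) * Real.exp (-(deltaU d a * dist (blk n p) y')))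
            * (cC d a * Real.exp (-(deltaC d a * dist y' y))) :=
          mul_le_mul h1 h2 (abs_nonneg _) (by have := cU_pos d ha; positivity)
      _ = K * (Real.exp (-(deltaU d a * dist (blk n p) y')) * Real.exp (-(deltaC d a * dist y y'))) := by
          rw [hK, dist_comm y y']; ring
      _ ≤ K * (Real.exp (-(min (deltaU d a) (deltaC d a) / 2 * dist (blk n p) y))
            * Real.exp (-(deltaC d a / 2 * dist y y'))) := mul_le_mul_of_nonneg_left hsplit hK0
      _ = K * Real.exp (-(deltaP d a * dist (blk n p) y)) * Real.exp (-(deltaC d a / 2 * dist y y')) := by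
          rw [deltaP]; ring
  calc |kerP n a p y| ≤ _ := key
    _ = cP d n a * Real.exp (-(deltaP d a * dist (blk n p) y)) := by rw [cP, hK]; ring

/-- [folklore] Absolute convergence of the series defining `P(p,q)` (majorant `c_P·c_u(n+1)^{d/2}·e^{−δ_P|blk p − y|}`). -/
theorem summable_Pker (n : ℕ) {a : ℝ} (ha : 0 < a) (p q : X d) :
    Summable fun y : X d => kerP n a p y * gq n a q y := by
  refine Summable.of_norm_bounded
    ((summable_expX (deltaP_pos d ha) (blk n p)).mul_left (cP d n a * (cU d a * Real.sqrt (((n : ℝ) + 1) ^ d))))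
    fun y => ?_
  rw [Real.norm_eq_abs, abs_mul]
  have h1 := abs_kerP_le n ha p y
  have h2 := abs_gq_le_const n ha q y
  calc |kerP n a p y| * |gq n a q y|
      ≤ (cP d n a * Real.exp (-(deltaP d a * dist (blk n p) y))) * (cU d a * Real.sqrt (((n : ℝ) + 1) ^ d)) :=
        mul_le_mul h1 h2 (abs_nonneg _) (by have := cP_nonneg d n ha; positivity)
    _ = cP d n a * (cU d a * Real.sqrt (((n : ℝ) + 1) ^ d)) * Real.exp (-(deltaP d a * dist (blk n p) y)) := by ring

/-- [folklore] The constant of `P`: `c_PP = (n+1)^{−d}·c_P·c_u(n+1)^{d/2}·K_d(δ_u/2)`. -/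
def cPP (d n : ℕ) (a : ℝ) : ℝ :=
  (((n : ℝ) + 1) ^ d)⁻¹ * (cP d n a * (cU d a * Real.sqrt (((n : ℝ) + 1) ^ d)) * latticeConst d (deltaU d a / 2))

/-- [folklore] The rate of `P`: `δ_PP = min(δ_P, δ_u)/2`. -/
def deltaPP (d : ℕ) (a : ℝ) : ℝ := min (deltaP d a) (deltaU d a) / 2

/-- [folklore] `c_PP ≥ 0`. -/
theorem cPP_nonneg (d n : ℕ) {a : ℝ} (ha : 0 < a) : 0 ≤ cPP d n a := by
  unfold cPP; have := cP_nonneg d n ha; have := cU_pos d ha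
  have := latticeConst_nonneg d (half_pos (deltaU_pos d ha)).le; positivity

/-- [folklore] `δ_PP > 0`. -/
theorem deltaPP_pos (d : ℕ) {a : ℝ} (ha : 0 < a) : 0 < deltaPP d a := by
  unfold deltaPP; have := deltaP_pos d ha; have := deltaU_pos d ha; positivity

/-- [folklore] **`P` IS BLOCK-STRUCTURED**: `|P(p,q)| ≤ c_PP·e^{−δ_PP|blk p − blk q|_∞}` — decay in the BLOCK distance (rate `O(1)` per
block, i.e. `O(1/n)` per fine site), as the road's node A3 expects of the `D(1−R)D*` pieces. -/
theorem abs_Pker_le (n : ℕ) {a : ℝ} (ha : 0 < a) (p q : X d) :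
    |Pker n a p q| ≤ cPP d n a * Real.exp (-(deltaPP d a * dist (blk n p) (blk n q))) := by
  have hδP := deltaP_pos d ha
  have hδu := deltaU_pos d ha
  set K : ℝ := cP d n a * (cU d a * Real.sqrt (((n : ℝ) + 1) ^ d)) with hK
  have hK0 : 0 ≤ K := by rw [hK]; have := cP_nonneg d n ha; have := cU_pos d ha; positivity
  have key : |∑' y : X d, kerP n a p y * gq n a q y|
      ≤ (K * Real.exp (-(deltaPP d a * dist (blk n p) (blk n q)))) * latticeConst d (deltaU d a / 2) := by
    refine abs_tsum_le_latticeConst (half_pos hδu) (by positivity) (blk n q) fun y => ?_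
    rw [abs_mul]
    have h1 := abs_kerP_le n ha p y
    have h2 := abs_gq_le n ha q y
    have hsplit := exp_split_triangle hδP.le hδu.le (dist_nonneg (x := blk n p) (y := y))
      (dist_nonneg (x := y) (y := blk n q)) (dist_triangle (blk n p) y (blk n q))
    rw [dist_comm y (blk n q)] at hsplit
    calc |kerP n a p y| * |gq n a q y|
        ≤ (cP d n a * Real.exp (-(deltaP d a * dist (blk n p) y)))
            * (cU d a * Real.sqrt (((n : ℝ) + 1) ^ d) * Real.exp (-(deltaU d a * dist (blk n q) y))) :=
          mul_le_mul h1 h2 (abs_nonneg _) (by have := cP_nonneg d n ha; positivity)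
      _ = K * (Real.exp (-(deltaP d a * dist (blk n p) y)) * Real.exp (-(deltaU d a * dist (blk n q) y))) := by
          rw [hK]; ring
      _ ≤ K * (Real.exp (-(min (deltaP d a) (deltaU d a) / 2 * dist (blk n p) (blk n q)))
            * Real.exp (-(deltaU d a / 2 * dist (blk n q) y))) := mul_le_mul_of_nonneg_left hsplit hK0
      _ = K * Real.exp (-(deltaPP d a * dist (blk n p) (blk n q))) * Real.exp (-(deltaU d a / 2 * dist (blk n q) y)) := by
          rw [deltaPP]; ring
  have hN : (0 : ℝ) < ((n : ℝ) + 1) ^ d := by positivity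
  rw [Pker, abs_mul, abs_of_pos (inv_pos.2 hN)]
  calc (((n : ℝ) + 1) ^ d)⁻¹ * |∑' y : X d, kerP n a p y * gq n a q y|
      ≤ (((n : ℝ) + 1) ^ d)⁻¹ * ((K * Real.exp (-(deltaPP d a * dist (blk n p) (blk n q)))) * latticeConst d (deltaU d a / 2)) :=
        mul_le_mul_of_nonneg_left key (inv_pos.2 hN).le
    _ = cPP d n a * Real.exp (-(deltaPP d a * dist (blk n p) (blk n q))) := by rw [cPP, hK]; ring

/-- [folklore] **`P` IS SYMMETRIC**: `P(p,q) = P(q,p)` — symmetry of `C` and exchange of the two lattice sums under the exponential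
majorant (`tsum_mul_tsum_comm`). -/
theorem Pker_symm (n : ℕ) {a : ℝ} (ha : 0 < a) (p q : X d) : Pker n a p q = Pker n a q p := by
  have hδu := deltaU_pos d ha
  have hδC := deltaC_pos d ha
  -- the majorant for Fubini: |gq p y′ · (Csq y′ y · gq q y)| ≤ C e^{−δ_u|blk p − y′|} e^{−δ_C|y′ − y|}
  have hmaj : ∀ y' y : X d, |gq n a p y' * (Csq n a y' y * gq n a q y)|
      ≤ (cU d a * Real.sqrt (((n : ℝ) + 1) ^ d) * cC d a * (cU d a * Real.sqrt (((n : ℝ) + 1) ^ d)))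
        * Real.exp (-(deltaU d a * dist (blk n p) y')) * Real.exp (-(deltaC d a * dist y' y)) := by
    intro y' y
    rw [abs_mul, abs_mul]
    have h1 := abs_gq_le n ha p y'
    have h2 := abs_Csq_le n ha y' y
    have h3 := abs_gq_le_const n ha q y
    have hc1 := cU_pos d ha; have hc2 := cC_pos d ha
    have h23 : |Csq n a y' y| * |gq n a q y|
        ≤ (cC d a * Real.exp (-(deltaC d a * dist y' y))) * (cU d a * Real.sqrt (((n : ℝ) + 1) ^ d)) :=
      mul_le_mul h2 h3 (abs_nonneg _) (by positivity)
    calc |gq n a p y'| * (|Csq n a y' y| * |gq n a q y|)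
        ≤ (cU d a * Real.sqrt (((n : ℝ) + 1) ^ d) * Real.exp (-(deltaU d a * dist (blk n p) y')))
            * ((cC d a * Real.exp (-(deltaC d a * dist y' y))) * (cU d a * Real.sqrt (((n : ℝ) + 1) ^ d))) :=
          mul_le_mul h1 h23 (by positivity) (by positivity)
      _ = _ := by ring
  have hcomm := tsum_mul_tsum_comm (f := fun y' => gq n a p y') (g := fun y' y => Csq n a y' y * gq n a q y)
    hδu hδC (blk n p) hmaj
  -- left side of `hcomm` is `(n+1)^d · P(q,p)`, right side is `(n+1)^d · P(p,q)`
  have hL : ∑' y' : X d, gq n a p y' * ∑' y : X d, Csq n a y' y * gq n a q y = ∑' y' : X d, kerP n a q y' * gq n a p y' := by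
    refine tsum_congr fun y' => ?_
    have e : ∑' y : X d, Csq n a y' y * gq n a q y = kerP n a q y' := by
      rw [kerP]; exact tsum_congr fun y => by rw [Csq_symm n ha y' y, mul_comm]
    rw [e, mul_comm]
  have hR : ∑' y : X d, ∑' y' : X d, gq n a p y' * (Csq n a y' y * gq n a q y) = ∑' y : X d, kerP n a p y * gq n a q y := by
    refine tsum_congr fun y => ?_
    rw [kerP, ← tsum_mul_right]
    exact tsum_congr fun y' => by ring
  rw [Pker, Pker, ← hR, ← hcomm, hL]

/-! ## §3 The Euler–Lagrange identities of `G′Q′*C` and of `P` against the tower operator `Δ′_a = Δ^η + aQ′*Q′` -/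

/-- [folklore] **`Δ′_a·(G′Q′*C) = Q′*C`**, entrywise: `Σ_r A(p,r)(G′Q′*C)(r,y) = C(blk p, y)` (block-constant in `p`). -/
theorem sum_AX_mul_kerP (n : ℕ) {a : ℝ} (ha : 0 < a) (p y : X d) :
    ∑ r ∈ nbhd n p, AX n a p r * kerP n a r y = Csq n a (blk n p) y := by
  classical
  rw [sum_mul_kerP n ha (nbhd n p) (fun r => AX n a p r) y]
  rw [tsum_eq_single (blk n p) (fun y' hy' => by
    rw [sum_AX_mul_gq n ha p y', if_neg (Ne.symm hy'), zero_mul])]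
  rw [sum_AX_mul_gq n ha p (blk n p), if_pos rfl, one_mul]

/-- [folklore] Finite sums against `P` pass inside its series. -/
theorem sum_mul_Pker (n : ℕ) {a : ℝ} (ha : 0 < a) (S : Finset (X d)) (v : X d → ℝ) (q : X d) :
    ∑ p ∈ S, v p * Pker n a p q = (((n : ℝ) + 1) ^ d)⁻¹ * ∑' y : X d, (∑ p ∈ S, v p * kerP n a p y) * gq n a q y := by
  have hs : ∀ p ∈ S, Summable fun y : X d => v p * (kerP n a p y * gq n a q y) :=
    fun p _ => (summable_Pker n ha p q).mul_left (v p)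
  calc ∑ p ∈ S, v p * Pker n a p q
      = ∑ p ∈ S, (((n : ℝ) + 1) ^ d)⁻¹ * ∑' y : X d, v p * (kerP n a p y * gq n a q y) := by
        refine Finset.sum_congr rfl fun p _ => ?_
        rw [Pker, tsum_mul_left]; ring
    _ = (((n : ℝ) + 1) ^ d)⁻¹ * ∑ p ∈ S, ∑' y : X d, v p * (kerP n a p y * gq n a q y) := by
        rw [Finset.mul_sum]
    _ = (((n : ℝ) + 1) ^ d)⁻¹ * ∑' y : X d, ∑ p ∈ S, v p * (kerP n a p y * gq n a q y) := by
        rw [(Summable.tsum_finsetSum hs).symm]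
    _ = (((n : ℝ) + 1) ^ d)⁻¹ * ∑' y : X d, (∑ p ∈ S, v p * kerP n a p y) * gq n a q y := by
        refine congrArg _ (tsum_congr fun y => ?_)
        rw [Finset.sum_mul]; exact Finset.sum_congr rfl fun p _ => by ring

/-- [folklore] **`Δ′_a·P = (n+1)^{−d}·Q′*C Q′G′`**, entrywise: `Σ_r A(p,r)P(r,q) = (n+1)^{−d}·(G′Q′*C)(q, blk p)`. -/
theorem sum_AX_mul_Pker (n : ℕ) {a : ℝ} (ha : 0 < a) (p q : X d) :
    ∑ r ∈ nbhd n p, AX n a p r * Pker n a r q = (((n : ℝ) + 1) ^ d)⁻¹ * kerP n a q (blk n p) := by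
  rw [sum_mul_Pker n ha (nbhd n p) (fun r => AX n a p r) q, kerP]
  exact congrArg _ (tsum_congr fun y => by rw [sum_AX_mul_kerP n ha p y, Csq_symm n ha (blk n p) y, mul_comm])

/-! ## §4 THE GAUGE PROPERTY: `P` annihilates `Δ₀N(Q′)` (so `R = 1 − P` is the identity there) -/

/-- [folklore] **WEAK FORM**: for every finitely supported fine function `λ` (support in `S`) with VANISHING BLOCK SUMS (`λ ∈ N(Q′)`) and
every fine site `p`, `Σ_{r∈S} λ(r)·Σ_{q} A(r,q)·P(q,p) = 0` — because `Σ_q A(r,q)P(q,p) = (n+1)^{−d}(G′Q′*C)(p, blk r)` is BLOCK-CONSTANT in `r`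
(`sum_AX_mul_Pker`) and block-constant functions are orthogonal to `N(Q′)` (`sum_mul_blockConst_eq_zero`). -/
theorem sum_mul_AX_Pker_eq_zero (n : ℕ) {a : ℝ} (ha : 0 < a) (S : Finset (X d)) (lam : X d → ℝ)
    (hS : ∀ r ∉ S, lam r = 0) (hQ : ∀ y : X d, ∑ r ∈ B n y, lam r = 0) (p : X d) :
    ∑ r ∈ S, lam r * (∑ q ∈ nbhd n r, AX n a r q * Pker n a q p) = 0 := by
  rw [← sum_mul_blockConst_eq_zero S lam hS hQ (fun y : X d => (((n : ℝ) + 1) ^ d)⁻¹ * kerP n a p y)]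
  exact Finset.sum_congr rfl fun r _ => by rw [sum_AX_mul_Pker n ha r p]

/-- [folklore] The `aQ′*Q′` part of `Δ′_a` is by itself block-constant against `P`: `Σ_q 1[blk r = blk q]·P(q,p) = ψ(blk r)` with
`ψ(y) = Σ_{q∈B(y)} P(q,p)`; hence it, too, is orthogonal to `N(Q′)`. -/
theorem sum_mul_sameBlk_Pker_eq_zero (n : ℕ) {a : ℝ} (S : Finset (X d)) (lam : X d → ℝ)
    (hS : ∀ r ∉ S, lam r = 0) (hQ : ∀ y : X d, ∑ r ∈ B n y, lam r = 0) (p : X d) :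
    ∑ r ∈ S, lam r * (∑ q ∈ nbhd n r, sameBlk n r q * Pker n a q p) = 0 := by
  classical
  rw [← sum_mul_blockConst_eq_zero S lam hS hQ (fun y : X d => ∑ q ∈ B n y, Pker n a q p)]
  refine Finset.sum_congr rfl fun r _ => ?_
  congr 1
  -- the summand vanishes off the block of `r`, and the block of `r` is contained in `nbhd n r`
  have hsub : B n (blk n r) ⊆ nbhd n r := fun q hq => by
    simp only [nbhd, Finset.mem_union]; exact Or.inl (Or.inl hq)
  rw [← Finset.sum_subset hsub (fun q _ hq => by
    rw [sameBlk, if_neg (fun h => hq (mem_B.2 h.symm)), zero_mul])]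
  exact Finset.sum_congr rfl fun q hq => by rw [sameBlk, if_pos (mem_B.1 hq).symm, one_mul]

/-- [folklore] **THE GAUGE PROPERTY, LAPLACIAN FORM**: for `λ ∈ N(Q′)` finitely supported, `Σ_{r∈S} λ(r)·Σ_q (n+1)²(−Δ)(r,q)·P(q,p) = 0`, i.e.
`⟨Δ^η λ, P(·,p)⟩ = 0`: the range of `P` is orthogonal to `Δ₀N(Q′)`, equivalently `R = 1 − P` restricts to the identity on `Δ₀N(Q′)` —
the «onto `Δ_U N(Q′)`» half of B9 (3.21) at `U = 1` (the complementary half, `Pker² = Pker`, is the v1.1 item). -/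
theorem sum_mul_lap_Pker_eq_zero (n : ℕ) {a : ℝ} (ha : 0 < a) (S : Finset (X d)) (lam : X d → ℝ)
    (hS : ∀ r ∉ S, lam r = 0) (hQ : ∀ y : X d, ∑ r ∈ B n y, lam r = 0) (p : X d) :
    ∑ r ∈ S, lam r * (∑ q ∈ nbhd n r, ((n : ℝ) + 1) ^ 2 * lapKer r q * Pker n a q p) = 0 := by
  have hA := sum_mul_AX_Pker_eq_zero n ha S lam hS hQ p
  have hB := sum_mul_sameBlk_Pker_eq_zero n (a := a) S lam hS hQ p
  have e : ∀ r ∈ S, lam r * (∑ q ∈ nbhd n r, ((n : ℝ) + 1) ^ 2 * lapKer r q * Pker n a q p)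
      = lam r * (∑ q ∈ nbhd n r, AX n a r q * Pker n a q p)
        - a / ((n : ℝ) + 1) ^ d * (lam r * (∑ q ∈ nbhd n r, sameBlk n r q * Pker n a q p)) := by
    intro r _
    rw [Finset.mul_sum, Finset.mul_sum, Finset.mul_sum, Finset.mul_sum, ← Finset.sum_sub_distrib]
    refine Finset.sum_congr rfl fun q _ => ?_
    rw [AX]; ring
  rw [Finset.sum_congr rfl e, Finset.sum_sub_distrib, hA, ← Finset.mul_sum, hB, mul_zero, sub_zero]

/-- [folklore] **THE GAUGE PROPERTY, POINTWISE FORM `P·Δ₀λ = 0`**: for `λ ∈ N(Q′)` supported in `S`, and `W` any finite set of fine sites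
containing the support of `Δ₀λ` (e.g. `S.biUnion (nbhd n)`), `Σ_{q∈W} P(p,q)·(Σ_{r∈S} (n+1)²(−Δ)(q,r)λ(r)) = 0` — by the symmetry of `P` and of
`−Δ` this is the weak form read from the other side. -/
theorem sum_Pker_mul_lap_eq_zero (n : ℕ) {a : ℝ} (ha : 0 < a) (S : Finset (X d)) (lam : X d → ℝ)
    (hS : ∀ r ∉ S, lam r = 0) (hQ : ∀ y : X d, ∑ r ∈ B n y, lam r = 0) (p : X d)
    (W : Finset (X d)) (hW : ∀ r ∈ S, nbhd n r ⊆ W) :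
    ∑ q ∈ W, Pker n a p q * (∑ r ∈ S, ((n : ℝ) + 1) ^ 2 * lapKer q r * lam r) = 0 := by
  have h := sum_mul_lap_Pker_eq_zero n ha S lam hS hQ p
  -- rewrite the inner sums of `h` over the window `W` (the Laplacian row of `r` vanishes off `nbhd n r ⊆ W`)
  have e : ∀ r ∈ S, lam r * (∑ q ∈ nbhd n r, ((n : ℝ) + 1) ^ 2 * lapKer r q * Pker n a q p)
      = ∑ q ∈ W, Pker n a p q * (((n : ℝ) + 1) ^ 2 * lapKer q r * lam r) := by
    intro r hr
    rw [Finset.mul_sum]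
    rw [← Finset.sum_subset (hW r hr) (fun q _ hq => by
      rw [lapKer_symm q r, lapKer_eq_zero_of_not_mem hq, mul_zero, zero_mul, mul_zero])]
    refine Finset.sum_congr rfl fun q _ => ?_
    rw [lapKer_symm r q, Pker_symm n ha q p]; ring
  rw [Finset.sum_congr rfl e, Finset.sum_comm] at h
  simpa only [Finset.mul_sum] using h

/-! ## §5 Road currency (`d = 4`, block side `n ≥ 1` as in `D1BFx/GhostLeg`: `Ggh n a = Gk (n − 1) a`) -/

open Literature.MathematicalPhysics.QuantumFieldTheory.Balaban1983to89.Beta.ExpKernelCalculus (MKer)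

/-- [our object] **THE `R`-PROJECTOR'S COMPLEMENT `P` IN THE ROAD'S CURRENCY**: `Pgt n a : MKer 4 Unit`, block side `n` (the typer's `Ggh n a`
is `Gk (n−1) a`, so `P` over `Ggh` is `Pker (n−1) a`). -/
def Pgt (n : ℕ) (a : ℝ) : MKer 4 Unit := fun x y _ _ => Pker (d := 4) (n - 1) a x y

/-- [our object] Unfolding of `Pgt`. -/
theorem Pgt_apply (n : ℕ) (a : ℝ) (x y : X 4) (u v : Unit) : Pgt n a x y u v = Pker (d := 4) (n - 1) a x y := rfl

/-- [folklore] `Pgt` is symmetric. -/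
theorem Pgt_symm (n : ℕ) {a : ℝ} (ha : 0 < a) (x y : X 4) (u v : Unit) : Pgt n a x y u v = Pgt n a y x v u := by
  rw [Pgt_apply, Pgt_apply, Pker_symm (n - 1) ha x y]

/-- [folklore] `Pgt` is block-structured: `|Pgt n a x y| ≤ c_PP(4, n−1, a)·e^{−δ_PP(4,a)|blk x − blk y|_∞}` (blocks of side `n`). -/
theorem abs_Pgt_le (n : ℕ) {a : ℝ} (ha : 0 < a) (x y : X 4) (u v : Unit) :
    |Pgt n a x y u v| ≤ cPP 4 (n - 1) a * Real.exp (-(deltaPP 4 a * dist (blk (n - 1) x) (blk (n - 1) y))) := by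
  rw [Pgt_apply]; exact abs_Pker_le (n - 1) ha x y

end

end Summit.QuantumFields.BalabanUV.Beta.D1BFx.RProjector
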